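import Summits.HodgeConjecture.HodgeConjecture.Theorems.Ring2WeilCoverageRealUnitNormFrobenius
import Summits.HodgeConjecture.HodgeConjecture.Theorems.Ring2WeilCoverageFullSignature
import Mathlib.Data.Nat.Factorization.Basic
import Mathlib.RingTheory.Ideal.Quotient.Basic
import HarnessLib

/-!
# Weil-type family coverage — THEOREM L (i) AT EVERY LEVEL: for `n = n₀·q^b` with `q` an ODD prime, `b ≥ 1`, `q ∤ n₀`,
# `n₀ ≥ 3` — equivalently for every `n` not of the form `2^a`, `p^a`, `2p^a` — NO unit of `ℚ(ζₙ)⁺` has norm `−1`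

research route conditional on HC_CM; not a corollary; Q11.4-sentence-2 already refuted in dim ≥ 3.

Ring 2, WEIL-TYPE FAMILY-COVERAGE CENSUS (`HOME/WEIL-FAMILY-COVERAGE.md` `## b01`, block b01.44; owner ring2-b01), part 67
of the `Ring2WeilCoverage*` series.  Part 66 reduced THEOREM L (i) for `K = ℚ(ζₙ)`, `n = n₀·q^b`, to the existence of a
ring map `ψ : ℤ[ζ] → R` into a commutative ring of characteristic `q` with `2 ≠ 0` and `ψ(ζ)^{n₀} = 1`.  Here `ψ` is
the reduction modulo a maximal ideal `𝔔` of `ℤ[ζ]` containing the odd prime `q` (`q` is not a unit of `ℤ[ζ]`: its norm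
is `q^{[K:ℚ]}`): the residue field has characteristic `q ≠ 2`, and `(ψ(ζ)^{n₀})^{q^b} = ψ(ζ^n) = 1` forces
`ψ(ζ)^{n₀} = 1` because `x ↦ x^{q^b}` is injective on a field of characteristic `q` (`(x − 1)^{q^b} = x^{q^b} − 1`).

* §1 **`norm_realUnits_pos`** — THEOREM L (i) for every `n = n₀·q^b` (`q` odd prime, `b ≥ 1`, `(n₀, q) = 1`, `n₀ ≥ 3`);
  `norm_realUnits_pos_of_dvd` — the same from `q ∣ n` odd and `n / q^{v_q(n)} ≥ 3`; and the complete case split of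
  the non-exceptional levels: `norm_realUnits_pos_of_two_odd_primes` (two distinct odd primes divide `n`) and
  `norm_realUnits_pos_of_four_dvd` (`4` and an odd prime divide `n`).  The EXCEPTIONAL levels `2^a`, `p^a`, `2p^a` are
  genuinely exceptional: at `32` every signature occurs (part 61), and `N(−1) = −1` whenever `[ℚ(ζₙ)⁺ : ℚ]` is odd.
* §2 two consequences: `not_forall_sign` — at such a level NO CM type `Φ` of `ℚ(ζₙ)` has every sign pattern
  `S ⊆ Φ` realised by a real unit (part 60: a full signature forces a unit of norm `−1`), i.e. the units of `ℚ(ζₙ)⁺`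
  do NOT have all `2^{[ℚ(ζₙ)⁺:ℚ]}` signatures; and `norm_neg_one_of_odd_finrank` — in a field of odd degree `−1`
  itself has norm `−1` (why the levels `4`, `p^a`, `2p^a` with `p ≡ 3 (mod 4)` are exceptional).
* §3 the levels the census and the atlas meet beyond parts 8–63: `39 = 3·13` and `56 = 8·7` (the index-`2` levels, so
  far only with the RELATIVE law of part 33; at `56` the one-orbit engine of part 62 does not apply since
  `⟨7, −1⟩ ≠ (ℤ/8)ˣ`), and `15`, `20`, `24` (the `h_K = 2` ladder `ℚ(√−15) ⊂ ℚ(ζ₁₅)`, `ℚ(√−5) ⊂ ℚ(ζ₂₀)`,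
  `ℚ(√−6) ⊂ ℚ(ζ₂₄)` of the census's LEMMA F list).  The thirteen non-prime-power census levels of parts 8–63 are all
  instances of §1 as well (not restated).

WHAT THIS GIVES THE CENSUS: the hypothesis `hN` of parts 2/7/48/53/55/60b holds at EVERY cyclotomic level except
`2^a, p^a, 2p^a`; with part 60b's dichotomy, the norm-sign law of parts 55/56 is two-sided wherever THEOREM L (ii) is
available, and the full-signature degeneration of part 61 can only happen at prime-power levels.

HONEST FRAMING: elementary algebraic number theory; nothing here is a statement about Hodge classes, `W_K`, general
members or HC; `HC_CM` is used nowhere.  No `def`, no named fact, no `sorry`.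

References: [cite: Washington1997, §2, Prop. 2.16 and Thm. 2.5]; [cite: Garbanati1976UnitsNormMinusOne] (background:
units of norm `−1` in real abelian fields); census b01.28 THEOREM L (i), b01.44 (seat-derived proof).
-/

noncomputable section

open scoped Classical nonZeroDivisors NumberField
open NumberField Module Polynomial Finset

namespace Summit.HodgeConjecture.Ring2WeilCoverage.RealUnitNormAllLevels

open Literature.AlgebraicGeometry.Motives (CMType)
open Summit.HodgeConjecture.Ring2WeilCoverage.RealUnitNormFrobenius (norm_realUnits_pos_of_ringHom)
open Summit.HodgeConjecture.Ring2WeilCoverage.FullSignature (exists_realUnits_norm_neg_of_forall_sign)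

/-! ### §1 THEOREM L (i) at every level `n = n₀·q^b` -/

section AllLevels

variable {K : Type} [Field K] [NumberField K] [IsCMField K] {n : ℕ} [NeZero n] {ζ : K}

/-- **THEOREM L (i) AT EVERY LEVEL.**  Let `K = ℚ(ζₙ)` with `n = n₀·q^b`, `q` an ODD prime, `b ≥ 1`,
`(n₀, q) = 1` and `n₀ ≥ 3`.  Then every unit of `𝓞 K⁺` has positive norm: NO unit of `ℚ(ζₙ)⁺` has norm `−1`.
(The levels not of this form are `2^a`, `p^a`, `2p^a`, where the statement fails in general: part 61 at `32`;
`N(−1) = −1` whenever `[K⁺ : ℚ]` is odd.)  Reduction modulo a maximal ideal `𝔔 ∋ q` of `ℤ[ζ]`: the residue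
field has characteristic `q ≠ 2` and the `q`-power roots of unity die in it, so part 66's engine applies.
research route conditional on HC_CM; not a corollary; Q11.4-sentence-2 already refuted in dim ≥ 3. [cite: Washington1997, §2, Prop. 2.16] -/
theorem norm_realUnits_pos [IsCyclotomicExtension {n} ℚ K] (hζ : IsPrimitiveRoot ζ n) {n₀ q b : ℕ}
    (hq : q.Prime) (hq2 : q ≠ 2) (hn : n = n₀ * q ^ b) (hb : b ≠ 0) (hcop : n₀.Coprime q) (hn₀ : 2 < n₀)
    (v : (𝓞 (maximalRealSubfield K))ˣ) :
    0 < Algebra.norm ℚ (((v : 𝓞 (maximalRealSubfield K)) : maximalRealSubfield K)) := by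
  haveI := Fact.mk hq
  -- `q` is not a unit of `𝓞 K`: its norm is `q^[K:ℚ]`
  have hqu : ¬ IsUnit ((q : ℕ) : 𝓞 K) := by
    intro h
    have h1 := h.map (Algebra.norm ℤ)
    rw [show ((q : ℕ) : 𝓞 K) = algebraMap ℤ (𝓞 K) (q : ℤ) by simp, Algebra.norm_algebraMap,
      RingOfIntegers.rank, isUnit_pow_iff Module.finrank_pos.ne'] at h1
    rcases Int.isUnit_iff.mp h1 with h1 | h1
    · have := hq.two_le; omega
    · have := hq.two_le; omega
  obtain ⟨𝔔, h𝔔max, h𝔔⟩ := Ideal.exists_le_maximal (Ideal.span {((q : ℕ) : 𝓞 K)})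
    (fun h => hqu (Ideal.span_singleton_eq_top.mp h))
  letI := Ideal.Quotient.field 𝔔
  have hq0 : ((q : ℕ) : 𝓞 K ⧸ 𝔔) = 0 := by
    rw [← map_natCast (Ideal.Quotient.mk 𝔔), Ideal.Quotient.eq_zero_iff_mem]
    exact h𝔔 (Ideal.mem_span_singleton_self _)
  haveI : CharP (𝓞 K ⧸ 𝔔) q := (CharP.charP_iff_prime_eq_zero hq).mpr hq0
  have h2 : (2 : 𝓞 K ⧸ 𝔔) ≠ 0 := by
    intro h
    have hdvd : q ∣ 2 := (CharP.cast_eq_zero_iff (𝓞 K ⧸ 𝔔) q 2).mp (by exact_mod_cast h)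
    have := Nat.le_of_dvd two_pos hdvd
    have := hq.two_le
    omega
  have hr : Ideal.Quotient.mk 𝔔 hζ.toInteger ^ n₀ = 1 := by
    have hN : (Ideal.Quotient.mk 𝔔 hζ.toInteger ^ n₀) ^ q ^ b = 1 := by
      rw [← pow_mul, ← hn, ← map_pow, (hζ.toInteger_isPrimitiveRoot).pow_eq_one, map_one]
    have h0 : (Ideal.Quotient.mk 𝔔 hζ.toInteger ^ n₀ - 1) ^ q ^ b = 0 := by
      rw [sub_pow_char_pow, hN, one_pow, sub_self]
    exact sub_eq_zero.mp ((pow_eq_zero_iff (pow_ne_zero b hq.ne_zero)).mp h0)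
  exact norm_realUnits_pos_of_ringHom hζ hn hb hcop hn₀ h2 (Ideal.Quotient.mk 𝔔) hr v

/-- **THEOREM L (i) AT EVERY LEVEL, factorisation form**: if an odd prime `q` divides `n` and the prime-to-`q`
part `n / q^{v_q(n)}` of `n` is at least `3`, then every unit of `ℚ(ζₙ)⁺` has positive norm.
research route conditional on HC_CM; not a corollary; Q11.4-sentence-2 already refuted in dim ≥ 3. [cite: Washington1997, §2, Prop. 2.16] -/
theorem norm_realUnits_pos_of_dvd [IsCyclotomicExtension {n} ℚ K] (hζ : IsPrimitiveRoot ζ n) {q : ℕ}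
    (hq : q.Prime) (hq2 : q ≠ 2) (hqn : q ∣ n) (h3 : 2 < n / q ^ n.factorization q)
    (v : (𝓞 (maximalRealSubfield K))ˣ) :
    0 < Algebra.norm ℚ (((v : 𝓞 (maximalRealSubfield K)) : maximalRealSubfield K)) := by
  have hn0 : n ≠ 0 := NeZero.ne n
  exact norm_realUnits_pos hζ hq hq2 (n₀ := n / q ^ n.factorization q) (b := n.factorization q)
    (by rw [mul_comm]; exact (Nat.ordProj_mul_ordCompl_eq_self n q).symm)
    (hq.factorization_pos_of_dvd hn0 hqn).ne' (Nat.coprime_ordCompl hq hn0).symm h3 v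

/-- **Two distinct odd primes**: if odd primes `p ≠ q` both divide `n`, every unit of `ℚ(ζₙ)⁺` has positive norm.
research route conditional on HC_CM; not a corollary; Q11.4-sentence-2 already refuted in dim ≥ 3. [cite: Washington1997, §2, Prop. 2.16] -/
theorem norm_realUnits_pos_of_two_odd_primes [IsCyclotomicExtension {n} ℚ K] (hζ : IsPrimitiveRoot ζ n)
    {p q : ℕ} (hp : p.Prime) (hq : q.Prime) (hp2 : p ≠ 2) (hq2 : q ≠ 2) (hpq : p ≠ q) (hpn : p ∣ n)
    (hqn : q ∣ n) (v : (𝓞 (maximalRealSubfield K))ˣ) :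
    0 < Algebra.norm ℚ (((v : 𝓞 (maximalRealSubfield K)) : maximalRealSubfield K)) := by
  have hn0 : n ≠ 0 := NeZero.ne n
  refine norm_realUnits_pos_of_dvd hζ hq hq2 hqn ?_ v
  -- `p` divides the prime-to-`q` part, so it is `≥ p ≥ 3`
  have hpd : p ∣ n / q ^ n.factorization q := by
    have hcp : Nat.Coprime p (q ^ n.factorization q) :=
      (Nat.coprime_primes hp hq |>.mpr hpq).pow_right _
    exact hcp.dvd_of_dvd_mul_left (by rw [Nat.ordProj_mul_ordCompl_eq_self]; exact hpn)
  have := Nat.le_of_dvd (Nat.ordCompl_pos q hn0) hpd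
  have := hp.two_le
  omega

/-- **`4` and an odd prime**: if `4 ∣ n` and an odd prime `q` divides `n`, every unit of `ℚ(ζₙ)⁺` has positive norm.
research route conditional on HC_CM; not a corollary; Q11.4-sentence-2 already refuted in dim ≥ 3. [cite: Washington1997, §2, Prop. 2.16] -/
theorem norm_realUnits_pos_of_four_dvd [IsCyclotomicExtension {n} ℚ K] (hζ : IsPrimitiveRoot ζ n) {q : ℕ}
    (hq : q.Prime) (hq2 : q ≠ 2) (hqn : q ∣ n) (h4 : 4 ∣ n) (v : (𝓞 (maximalRealSubfield K))ˣ) :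
    0 < Algebra.norm ℚ (((v : 𝓞 (maximalRealSubfield K)) : maximalRealSubfield K)) := by
  have hn0 : n ≠ 0 := NeZero.ne n
  refine norm_realUnits_pos_of_dvd hζ hq hq2 hqn ?_ v
  have h4d : 4 ∣ n / q ^ n.factorization q := by
    have hcp : Nat.Coprime 4 (q ^ n.factorization q) := by
      have : Nat.Coprime 2 q := (Nat.coprime_primes Nat.prime_two hq).mpr (Ne.symm hq2)
      simpa using (this.pow_left 2).pow_right (n.factorization q)
    exact hcp.dvd_of_dvd_mul_left (by rw [Nat.ordProj_mul_ordCompl_eq_self]; exact h4)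
  have := Nat.le_of_dvd (Nat.ordCompl_pos q hn0) h4d
  omega

/-! ### §2 Consequences: no full signature; odd degree -/

/-- **NO FULL UNIT SIGNATURE outside the exceptional levels.**  At a level `n = n₀·q^b` (`q` odd prime, `b ≥ 1`,
`(n₀, q) = 1`, `n₀ ≥ 3`) NO CM type `Φ` of `K = ℚ(ζₙ)` has the full-signature property «every `S ⊆ Φ` is the set of
places in `Φ` where some real unit of `𝓞 K` is negative»: by part 60 such a `Φ` yields a unit of `𝓞 K⁺` of negative
norm, contradicting §1.  (At `32` every CM type HAS the property, part 61.)
research route conditional on HC_CM; not a corollary; Q11.4-sentence-2 already refuted in dim ≥ 3. [cite: Garbanati1976UnitsNormMinusOne] -/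
theorem not_forall_sign [IsCyclotomicExtension {n} ℚ K] (hζ : IsPrimitiveRoot ζ n) {n₀ q b : ℕ} (hq : q.Prime)
    (hq2 : q ≠ 2) (hn : n = n₀ * q ^ b) (hb : b ≠ 0) (hcop : n₀.Coprime q) (hn₀ : 2 < n₀) (Φ : CMType K) :
    ¬ ∀ S : Set (K →+* ℂ), S ⊆ Φ.1 →
      ∃ u : (𝓞 K)ˣ, IsCMField.complexConj K ((u : 𝓞 K) : K) = ((u : 𝓞 K) : K) ∧
        ∀ φ ∈ Φ.1, ((φ ((u : 𝓞 K) : K)).re < 0 ↔ φ ∈ S) := by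
  intro hU
  obtain ⟨v, hv⟩ := exists_realUnits_norm_neg_of_forall_sign Φ hU
  exact lt_asymm hv (norm_realUnits_pos hζ hq hq2 hn hb hcop hn₀ v)

/-- **Odd degree: `N(−1) = −1`.**  In a number field `L` of odd degree the unit `−1` has norm `−1`; so THEOREM L (i)
fails trivially for `ℚ(ζₙ)⁺` of odd degree, i.e. at the levels `n = 4, p^a, 2p^a` with `p ≡ 3 (mod 4)` — part of the
exceptional set `{2^a, p^a, 2p^a}` of §1.
research route conditional on HC_CM; not a corollary; Q11.4-sentence-2 already refuted in dim ≥ 3. [folklore] -/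
theorem norm_neg_one_of_odd_finrank {L : Type*} [Field L] [Algebra ℚ L] [FiniteDimensional ℚ L]
    (hodd : Odd (Module.finrank ℚ L)) : Algebra.norm ℚ (-1 : L) = -1 := by
  rw [show (-1 : L) = algebraMap ℚ L (-1) by rw [map_neg, map_one], Algebra.norm_algebraMap, hodd.neg_one_pow]

end AllLevels

/-! ### §3 Levels: the index-`2` levels `39`, `56` and the `h_K = 2` ladder levels `15`, `20`, `24` -/

section Levels

variable {K : Type} [Field K] [NumberField K] [IsCMField K] {ζ : K}

/-- **THEOREM L (i) AT `M = 39 = 13·3`**: every unit of `𝓞(ℚ(ζ₃₉)⁺)` has positive norm (absolute form; the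
relative form to `ℚ(√13)` is part 33).
research route conditional on HC_CM; not a corollary; Q11.4-sentence-2 already refuted in dim ≥ 3. [cite: Washington1997, §2, Prop. 2.16] -/
theorem norm_realUnits_pos_thirtyNine [IsCyclotomicExtension {39} ℚ K] (hζ : IsPrimitiveRoot ζ 39)
    (v : (𝓞 (maximalRealSubfield K))ˣ) :
    0 < Algebra.norm ℚ (((v : 𝓞 (maximalRealSubfield K)) : maximalRealSubfield K)) :=
  norm_realUnits_pos hζ (n₀ := 13) (q := 3) (b := 1) (by norm_num) (by norm_num) (by norm_num) one_ne_zero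
    (by norm_num) (by norm_num) v

/-- **THEOREM L (i) AT `M = 56 = 8·7`**: every unit of `𝓞(ℚ(ζ₅₆)⁺)` has positive norm (absolute form; the
relative form to `ℚ(√2)` is part 33; the one-orbit engine of part 62 does not apply here, `⟨7, −1⟩ ≠ (ℤ/8)ˣ`).
research route conditional on HC_CM; not a corollary; Q11.4-sentence-2 already refuted in dim ≥ 3. [cite: Washington1997, §2, Prop. 2.16] -/
theorem norm_realUnits_pos_fiftySix [IsCyclotomicExtension {56} ℚ K] (hζ : IsPrimitiveRoot ζ 56)
    (v : (𝓞 (maximalRealSubfield K))ˣ) :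
    0 < Algebra.norm ℚ (((v : 𝓞 (maximalRealSubfield K)) : maximalRealSubfield K)) :=
  norm_realUnits_pos hζ (n₀ := 8) (q := 7) (b := 1) (by norm_num) (by norm_num) (by norm_num) one_ne_zero
    (by norm_num) (by norm_num) v

/-- **THEOREM L (i) AT `M = 15 = 5·3`** (`ℚ(√−15) ⊂ ℚ(ζ₁₅)`, the `h_K = 2` ladder).
research route conditional on HC_CM; not a corollary; Q11.4-sentence-2 already refuted in dim ≥ 3. [cite: Washington1997, §2, Prop. 2.16] -/
theorem norm_realUnits_pos_fifteen [IsCyclotomicExtension {15} ℚ K] (hζ : IsPrimitiveRoot ζ 15)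
    (v : (𝓞 (maximalRealSubfield K))ˣ) :
    0 < Algebra.norm ℚ (((v : 𝓞 (maximalRealSubfield K)) : maximalRealSubfield K)) :=
  norm_realUnits_pos hζ (n₀ := 5) (q := 3) (b := 1) (by norm_num) (by norm_num) (by norm_num) one_ne_zero
    (by norm_num) (by norm_num) v

/-- **THEOREM L (i) AT `M = 20 = 4·5`** (`ℚ(√−5) ⊂ ℚ(ζ₂₀)`; `ℚ(ζ₂₀)⁺ ⊇ ℚ(√5)` has units of norm `−1`, the quartic
field has none).
research route conditional on HC_CM; not a corollary; Q11.4-sentence-2 already refuted in dim ≥ 3. [cite: Washington1997, §2, Prop. 2.16] -/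
theorem norm_realUnits_pos_twenty [IsCyclotomicExtension {20} ℚ K] (hζ : IsPrimitiveRoot ζ 20)
    (v : (𝓞 (maximalRealSubfield K))ˣ) :
    0 < Algebra.norm ℚ (((v : 𝓞 (maximalRealSubfield K)) : maximalRealSubfield K)) :=
  norm_realUnits_pos hζ (n₀ := 4) (q := 5) (b := 1) (by norm_num) (by norm_num) (by norm_num) one_ne_zero
    (by norm_num) (by norm_num) v

/-- **THEOREM L (i) AT `M = 24 = 8·3`** (`ℚ(√−6) ⊂ ℚ(ζ₂₄)`; `ℚ(ζ₂₄)⁺ = ℚ(√2, √3) ⊇ ℚ(√2)`).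
research route conditional on HC_CM; not a corollary; Q11.4-sentence-2 already refuted in dim ≥ 3. [cite: Washington1997, §2, Prop. 2.16] -/
theorem norm_realUnits_pos_twentyFour [IsCyclotomicExtension {24} ℚ K] (hζ : IsPrimitiveRoot ζ 24)
    (v : (𝓞 (maximalRealSubfield K))ˣ) :
    0 < Algebra.norm ℚ (((v : 𝓞 (maximalRealSubfield K)) : maximalRealSubfield K)) :=
  norm_realUnits_pos hζ (n₀ := 8) (q := 3) (b := 1) (by norm_num) (by norm_num) (by norm_num) one_ne_zero
    (by norm_num) (by norm_num) v

end Levels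

end Summit.HodgeConjecture.Ring2WeilCoverage.RealUnitNormAllLevels

end
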